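import Mathlib
import HarnessLib

/-!
# `NoHeavyLowerTail` (stmt-CriticalPhenomena-4575) — three-star hair words: the port set is contained in the three designated ports

Support file (prover `prim-gen-swap` gen 9; `--supports stmt-CriticalPhenomena-4575`).  No definitions, no named facts, no sorries; Mathlib only.

Companion of …StarSetWordPorts for the `r`-AVOIDING budget of the supply inequality U1'_r (MWF-CERT §7): if a word designates only the
stars `i, j, k`, to the ports `di, dj, dk`, then its port set `R_w = p(w⁻¹1) ∪ p'(w⁻¹2)` is contained in `{di, dj, dk}`; hence a word whose
three ports avoid a set `X` is an `X`-avoiding budget word.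

* `StarSet.ports_subset_three`, `StarSet.ports_avoid_of_three`.
-/

namespace Summit.CriticalPhenomena.PercolationContinuityZ3.Theorems

open Finset
open scoped BigOperators

namespace StarSet

variable {m n : ℕ}

/-- **The ports of a three-star word are the three designated ports.** [folklore] -/
theorem ports_subset_three (p p' : Fin m → Fin n) (w : Fin m → Fin 3) (i j k : Fin m) (di dj dk : Fin n)
    (hi : (w i = 1 ∧ di = p i) ∨ (w i = 2 ∧ di = p' i)) (hj : (w j = 1 ∧ dj = p j) ∨ (w j = 2 ∧ dj = p' j))
    (hk : (w k = 1 ∧ dk = p k) ∨ (w k = 2 ∧ dk = p' k)) (h0 : ∀ x, x ≠ i → x ≠ j → x ≠ k → w x = 0) :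
    (univ.filter fun y => w y = 1).image p ∪ (univ.filter fun y => w y = 2).image p' ⊆ ({di, dj, dk} : Finset (Fin n)) := by
  intro d hd
  simp only [mem_insert, mem_singleton]
  -- the star `x` that put `d` into the port set
  have key : ∀ x, (w x = 1 ∧ d = p x) ∨ (w x = 2 ∧ d = p' x) → d = di ∨ d = dj ∨ d = dk := by
    intro x hx
    have hx0 : w x ≠ 0 := by rcases hx with ⟨h, _⟩ | ⟨h, _⟩ <;> rw [h] <;> decide
    have hdes : ∀ (y : Fin m) (dy : Fin n), ((w y = 1 ∧ dy = p y) ∨ (w y = 2 ∧ dy = p' y)) → x = y → d = dy := by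
      intro y dy hy hxy
      subst hxy
      rcases hx with ⟨h1, h2⟩ | ⟨h1, h2⟩ <;> rcases hy with ⟨h3, h4⟩ | ⟨h3, h4⟩
      · rw [h2, h4]
      · rw [h1] at h3; exact absurd h3 (by decide)
      · rw [h1] at h3; exact absurd h3 (by decide)
      · rw [h2, h4]
    by_cases hxi : x = i
    · exact Or.inl (hdes i di hi hxi)
    by_cases hxj : x = j
    · exact Or.inr (Or.inl (hdes j dj hj hxj))
    by_cases hxk : x = k
    · exact Or.inr (Or.inr (hdes k dk hk hxk))
    exact absurd (h0 x hxi hxj hxk) hx0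
  rcases mem_union.1 hd with hd | hd
  · obtain ⟨x, hx, rfl⟩ := mem_image.1 hd
    exact key x (Or.inl ⟨(mem_filter.1 hx).2, rfl⟩)
  · obtain ⟨x, hx, rfl⟩ := mem_image.1 hd
    exact key x (Or.inr ⟨(mem_filter.1 hx).2, rfl⟩)

/-- A three-star word whose designated ports avoid `X` has an `X`-avoiding port set. [folklore] -/
theorem ports_avoid_of_three (p p' : Fin m → Fin n) (w : Fin m → Fin 3) (i j k : Fin m) (di dj dk : Fin n) (X : Finset (Fin n))
    (hi : (w i = 1 ∧ di = p i) ∨ (w i = 2 ∧ di = p' i)) (hj : (w j = 1 ∧ dj = p j) ∨ (w j = 2 ∧ dj = p' j))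
    (hk : (w k = 1 ∧ dk = p k) ∨ (w k = 2 ∧ dk = p' k)) (h0 : ∀ x, x ≠ i → x ≠ j → x ≠ k → w x = 0)
    (hdi : di ∉ X) (hdj : dj ∉ X) (hdk : dk ∉ X) :
    ∀ x ∈ X, x ∉ (univ.filter fun y => w y = 1).image p ∪ (univ.filter fun y => w y = 2).image p' := by
  intro x hx hmem
  have h := ports_subset_three p p' w i j k di dj dk hi hj hk h0 hmem
  simp only [mem_insert, mem_singleton] at h
  rcases h with rfl | rfl | rfl
  · exact hdi hx
  · exact hdj hx
  · exact hdk hx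

end StarSet

end Summit.CriticalPhenomena.PercolationContinuityZ3.Theorems
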